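import Literature.NumberTheory.LFunctions.FeketePolyaKernelSignTables
import HarnessLib

/-!
# Packed sign tables of induced quadratic characters, II: conductors `q`, `4m`, `8m` and the induced modulus

Topic `Literature/NumberTheory/LFunctions`; namespace `Literature.NumberTheory.LFunctions.FeketePolyaKernel`
(sequel of `FeketePolyaKernelSignTables.lean`). Small computable definitions and THEOREMS (no named fact, no
`sorry`): the sign tables `tabsOdd / tabsFour / tabsEightA / tabsEightB b ps q w` of the value stream
`n ↦ indVal (val…R (resTable ps)) (q·w) n` (`0 ≤ n < q·w`) of the induced character `χ↑(q·w)` for the primitive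
quadratic characters of conductor `q = ∏ ps` (odd), `q = 4·∏ ps`, `q = 8·∏ ps` (two patterns) — Jacobi tables of
the factor list (`jacTabs`), twisted by the period-`4` / period-`8` patterns of `χ₋₄`, `χ₋₈`, `χ₈`, masked to
`gcd(n, w) = 1` — and the identification theorems `isSignTab_tabsOdd/Four/EightA/EightB` (the positions with
`gcd(n, q·w) > 1` but `gcd(n, w) = 1` carry the value `0` already: a Jacobi symbol with a common factor vanishes,
and the `2`-part patterns vanish at even `n`). These tables feed the block certificates of
`FeketePolyaKernelCertificatesBlock.lean`.

## References

* H. L. Montgomery, R. C. Vaughan, *Multiplicative Number Theory I*, CUP 2007, §9.3 Thm 9.13, §11.2.1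
  Exercises 7–8. [MontgomeryVaughan2007]
-/

namespace Literature.NumberTheory.LFunctions

namespace FeketePolyaKernel

open Finset Literature.Analysis.Convolution FeketePolyaTable
open scoped NumberTheorySymbols

/-! ### The patterns of `χ₋₄`, `χ₋₈`, `χ₈` -/

/-- `tableVal l` is `|l|`-periodic. [cite: MontgomeryVaughan2007, §9.3 Theorem 9.13] -/
theorem tableVal_mod_length (l : List ℤ) (s : ℕ) : tableVal l (s % l.length) = tableVal l s := by
  unfold tableVal; rw [Nat.mod_mod]

/-- Sign tables of `χ₋₄ = [0, 1, 0, −1]` over one period: `(2^b, 2^{3b})`. [cite: MontgomeryVaughan2007, §9.3 Theorem 9.13] -/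
theorem isSignTab_four (b : ℕ) : IsSignTab b 4 (tableVal [0, 1, 0, -1]) (2 ^ b, 2 ^ (3 * b)) := by
  constructor <;> simp [kpack, Finset.sum_range_succ, tableVal, ind, Nat.mul_comm b 3]

/-- Sign tables of `χ₋₈ = [0, 1, 0, 1, 0, −1, 0, −1]`: `(2^b + 2^{3b}, 2^{5b} + 2^{7b})`. [cite: MontgomeryVaughan2007, §9.3 Theorem 9.13] -/
theorem isSignTab_eightA (b : ℕ) :
    IsSignTab b 8 (tableVal [0, 1, 0, 1, 0, -1, 0, -1]) (2 ^ b + 2 ^ (3 * b), 2 ^ (5 * b) + 2 ^ (7 * b)) := by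
  constructor <;> simp [kpack, Finset.sum_range_succ, tableVal, ind, Nat.mul_comm b]

/-- Sign tables of `χ₈ = [0, 1, 0, −1, 0, −1, 0, 1]`: `(2^b + 2^{7b}, 2^{3b} + 2^{5b})`. [cite: MontgomeryVaughan2007, §9.3 Theorem 9.13] -/
theorem isSignTab_eightB (b : ℕ) :
    IsSignTab b 8 (tableVal [0, 1, 0, -1, 0, -1, 0, 1]) (2 ^ b + 2 ^ (7 * b), 2 ^ (3 * b) + 2 ^ (5 * b)) := by
  constructor <;> simp [kpack, Finset.sum_range_succ, tableVal, ind, Nat.mul_comm b]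

/-- The three patterns take values in `{0, 1, −1}` and vanish at even arguments. [cite: MontgomeryVaughan2007, §9.3 Theorem 9.13] -/
theorem val3_tableVal_four (n : ℕ) : Val3 (tableVal [0, 1, 0, -1] n) ∧ (n % 2 = 0 → tableVal [0, 1, 0, -1] n = 0) := by
  have h4 : n % 4 < 4 := Nat.mod_lt n (by norm_num)
  unfold tableVal Val3
  simp only [List.length_cons, List.length_nil, Nat.reduceAdd]
  have hcase : ∀ r < 4, (n % 2 = 0 → r = n % 4 → r = 0 ∨ r = 2) := fun r _ h hr => by omega
  generalize hr : n % 4 = r at h4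
  interval_cases r <;> simp <;> omega

/-- Idem for `χ₋₈`. [cite: MontgomeryVaughan2007, §9.3 Theorem 9.13] -/
theorem val3_tableVal_eightA (n : ℕ) : Val3 (tableVal [0, 1, 0, 1, 0, -1, 0, -1] n) ∧
    (n % 2 = 0 → tableVal [0, 1, 0, 1, 0, -1, 0, -1] n = 0) := by
  have h8 : n % 8 < 8 := Nat.mod_lt n (by norm_num)
  unfold tableVal Val3
  simp only [List.length_cons, List.length_nil, Nat.reduceAdd]
  generalize hr : n % 8 = r at h8
  interval_cases r <;> simp <;> omega

/-- Idem for `χ₈`. [cite: MontgomeryVaughan2007, §9.3 Theorem 9.13] -/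
theorem val3_tableVal_eightB (n : ℕ) : Val3 (tableVal [0, 1, 0, -1, 0, -1, 0, 1] n) ∧
    (n % 2 = 0 → tableVal [0, 1, 0, -1, 0, -1, 0, 1] n = 0) := by
  have h8 : n % 8 < 8 := Nat.mod_lt n (by norm_num)
  unfold tableVal Val3
  simp only [List.length_cons, List.length_nil, Nat.reduceAdd]
  generalize hr : n % 8 = r at h8
  interval_cases r <;> simp <;> omega

/-- **Twisting sign tables by a periodic pattern**: `twistTabs` multiplies the represented function by the
`L`-periodic pattern (`L ∣ Q`). [cite: MontgomeryVaughan2007, §9.3 Theorem 9.13] -/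
theorem isSignTab_twistTabs {b Q L pp pm : ℕ} (hb : 1 ≤ b) (hL : 1 ≤ L) (hLQ : L ∣ Q) {y e : ℕ → ℤ}
    {PM : ℕ × ℕ} (hy : IsSignTab b Q y PM) (he : IsSignTab b L e (pp, pm)) (hper : ∀ s, e (s % L) = e s)
    (hy3 : ∀ n, Val3 (y n)) (he3 : ∀ n, Val3 (e n)) :
    IsSignTab b Q (fun n => e n * y n) (twistTabs b Q L pp pm PM) := by
  obtain ⟨P, M⟩ := PM
  unfold twistTabs
  exact (isSignTab_mulTab hb hy (isSignTab_pext hb hL hLQ he hper) hy3 he3).congr fun n _ => mul_comm _ _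

/-! ### The tables of the induced characters -/

/-- Tables of `χ↑(q·w)`, `χ = (·/q)`, `q = ∏ ps` odd. [cite: MontgomeryVaughan2007, §11.2.1 Exercise 8] -/
def tabsOdd (b : ℕ) (ps : List ℕ) (q w : ℕ) : ℕ × ℕ := maskTabs b (q * w) w (jacTabs b (q * w) ps)

/-- Tables of `χ↑(q·w)`, `χ = χ₋₄·(·/m)`, `q = 4m`, `m = ∏ ps`. [cite: MontgomeryVaughan2007, §11.2.1 Exercise 8] -/
def tabsFour (b : ℕ) (ps : List ℕ) (q w : ℕ) : ℕ × ℕ :=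
  maskTabs b (q * w) w (twistTabs b (q * w) 4 (2 ^ b) (2 ^ (3 * b)) (jacTabs b (q * w) ps))

/-- Tables of `χ↑(q·w)`, `χ = χ₋₈·(·/m)`, `q = 8m`. [cite: MontgomeryVaughan2007, §11.2.1 Exercise 8] -/
def tabsEightA (b : ℕ) (ps : List ℕ) (q w : ℕ) : ℕ × ℕ :=
  maskTabs b (q * w) w
    (twistTabs b (q * w) 8 (2 ^ b + 2 ^ (3 * b)) (2 ^ (5 * b) + 2 ^ (7 * b)) (jacTabs b (q * w) ps))

/-- Tables of `χ↑(q·w)`, `χ = χ₈·(·/m)`, `q = 8m`. [cite: MontgomeryVaughan2007, §11.2.1 Exercise 8] -/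
def tabsEightB (b : ℕ) (ps : List ℕ) (q w : ℕ) : ℕ × ℕ :=
  maskTabs b (q * w) w
    (twistTabs b (q * w) 8 (2 ^ b + 2 ^ (7 * b)) (2 ^ (3 * b) + 2 ^ (5 * b)) (jacTabs b (q * w) ps))

/-- The entries of a factor list of odd primes: primes, non-zero, dividing any multiple of the product. [folklore] -/
private theorem facts {ps : List ℕ} (hps : ps.Forall fun p ↦ p.Prime ∧ p ≠ 2) :
    (∀ p ∈ ps, p.Prime) ∧ ps.prod ≠ 0 ∧ ∀ c : ℕ, ∀ p ∈ ps, 1 ≤ p ∧ p ∣ ps.prod * c := by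
  rw [List.forall_iff_forall_mem] at hps
  refine ⟨fun p hp => (hps p hp).1, List.prod_ne_zero fun h => (hps 0 h).1.ne_zero rfl, fun c p hp => ?_⟩
  exact ⟨(hps p hp).1.one_lt.le, (List.dvd_prod hp).mul_right c⟩

/-- A Jacobi symbol with a common factor vanishes. [cite: MontgomeryVaughan2007, §9.3] -/
private theorem jac_eq_zero {n m : ℕ} (hm : m ≠ 0) (h : Nat.gcd n m ≠ 1) : J((n : ℤ) | m) = 0 := by
  haveI : NeZero m := ⟨hm⟩
  exact jacobiSym.eq_zero_iff_not_coprime.mpr (by rwa [Int.gcd_natCast_natCast])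

/-- If `gcd(n, 2^k · m) ≠ 1` then `n` is even or `gcd(n, m) ≠ 1`. [folklore] -/
private theorem even_or_of_gcd {n k m : ℕ} (h : Nat.gcd n (2 ^ k * m) ≠ 1) : n % 2 = 0 ∨ Nat.gcd n m ≠ 1 := by
  by_contra hc
  push Not at hc
  apply h
  have h2 : Nat.Coprime n 2 := by
    rw [Nat.coprime_comm, Nat.Prime.coprime_iff_not_dvd Nat.prime_two]
    omega
  exact Nat.Coprime.mul_right (h2.pow_right k) hc.2

/-- The trichotomy behind the mask: along `Q = q·w`, either `gcd(n, Q) = 1`, or `gcd(n, w) ≠ 1`, or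
`gcd(n, w) = 1` and `gcd(n, q) ≠ 1`. [folklore] -/
private theorem gcd_cases (n q w : ℕ) :
    Nat.gcd n (q * w) = 1 ∨ Nat.gcd n w ≠ 1 ∨ (Nat.gcd n w = 1 ∧ Nat.gcd n q ≠ 1) := by
  by_cases hw : Nat.gcd n w = 1
  · by_cases hq : Nat.gcd n q = 1
    · exact Or.inl (Nat.Coprime.mul_right hq hw)
    · exact Or.inr (Or.inr ⟨hw, hq⟩)
  · exact Or.inr (Or.inl hw)

/-- `gcd(n, Q) = 1` and `w ∣ Q` give `gcd(n, w) = 1`. [folklore] -/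
private theorem gcd_w_of_gcd_Q {n Q w : ℕ} (h : Nat.gcd n Q = 1) (hw : w ∣ Q) : Nat.gcd n w = 1 :=
  Nat.Coprime.coprime_dvd_right hw h

/-- The masked value equals the induced value: generic step. [folklore] -/
private theorem mask_eq_indVal {q w : ℕ} (v : ℕ → ℤ) (hv : ∀ n, Nat.gcd n q ≠ 1 → v n = 0) (n : ℕ) :
    (if Nat.gcd n w = 1 then v n else 0) = indVal v (q * w) n := by
  unfold indVal
  rcases gcd_cases n q w with h | h | ⟨h1, h2⟩
  · rw [if_pos (gcd_w_of_gcd_Q h (dvd_mul_left w q)), if_pos h]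
  · rw [if_neg h, if_neg fun h' => h (gcd_w_of_gcd_Q h' (dvd_mul_left w q))]
  · rw [if_pos h1, hv n h2]
    split <;> rfl

/-- **`tabsOdd` are the sign tables of the induced character `χ↑(q·w)`, `χ = (·/q)`, `q = ∏ ps` odd.**
[cite: MontgomeryVaughan2007, §11.2.1 Exercise 8] -/
theorem isSignTab_tabsOdd {b q w : ℕ} (hb : 2 ≤ b) (ps : List ℕ) (hps : ps.Forall fun p ↦ p.Prime ∧ p ≠ 2)
    (hprod : ps.prod = q) (hw : w ≠ 0) :
    IsSignTab b (q * w) (indVal (valOddR (resTable ps)) (q * w)) (tabsOdd b ps q w) := by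
  obtain ⟨hpr, hq0, hdv⟩ := facts hps
  rw [hprod] at hq0 hdv
  have hj := isSignTab_jacTabs (Q := q * w) hb ps (hdv w)
  refine (isSignTab_maskTabs (by omega) (Nat.one_le_iff_ne_zero.mpr hw) (dvd_mul_left w q) hj).congr
    fun n _ => mask_eq_indVal _ (fun n hn => ?_) n
  show jacVal (resTable ps) n = 0
  rw [jacVal_resTable ps hpr, hprod]
  exact jac_eq_zero hq0 hn

/-- **`tabsFour` are the sign tables of `χ↑(q·w)`, `χ = χ₋₄·(·/m)`, `q = 4m`, `m = ∏ ps`.**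
[cite: MontgomeryVaughan2007, §11.2.1 Exercise 8] -/
theorem isSignTab_tabsFour {b q w : ℕ} (hb : 2 ≤ b) (ps : List ℕ) (hps : ps.Forall fun p ↦ p.Prime ∧ p ≠ 2)
    (hprod : 4 * ps.prod = q) (hw : w ≠ 0) :
    IsSignTab b (q * w) (indVal (valFourR (resTable ps)) (q * w)) (tabsFour b ps q w) := by
  obtain ⟨hpr, hm0, hdv⟩ := facts hps
  have h4 : (4 : ℕ) ∣ q * w := hprod ▸ (dvd_mul_right 4 _).mul_right w
  have hj := isSignTab_jacTabs (Q := q * w) hb ps fun p hp => by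
    obtain ⟨h1, h2⟩ := hdv (4 * w) p hp
    exact ⟨h1, by rw [← hprod]; convert h2 using 1; ring⟩
  have ht := isSignTab_twistTabs (by omega) (by norm_num) h4 hj (isSignTab_four b)
    (fun s => tableVal_mod_length [0, 1, 0, -1] s) (val3_jacVal _) fun n => (val3_tableVal_four n).1
  refine (isSignTab_maskTabs (by omega) (Nat.one_le_iff_ne_zero.mpr hw) (dvd_mul_left w q) ht).congr
    fun n _ => mask_eq_indVal (valFourR (resTable ps)) (fun n hn => ?_) n
  show tableVal [0, 1, 0, -1] n * jacVal (resTable ps) n = 0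
  rw [← hprod, show (4 : ℕ) = 2 ^ 2 from rfl] at hn
  rcases even_or_of_gcd hn with he | hg
  · rw [(val3_tableVal_four n).2 he, zero_mul]
  · rw [jacVal_resTable ps hpr, jac_eq_zero hm0 hg, mul_zero]

/-- **`tabsEightA` are the sign tables of `χ↑(q·w)`, `χ = χ₋₈·(·/m)`, `q = 8m`, `m = ∏ ps`.**
[cite: MontgomeryVaughan2007, §11.2.1 Exercise 8] -/
theorem isSignTab_tabsEightA {b q w : ℕ} (hb : 2 ≤ b) (ps : List ℕ) (hps : ps.Forall fun p ↦ p.Prime ∧ p ≠ 2)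
    (hprod : 8 * ps.prod = q) (hw : w ≠ 0) :
    IsSignTab b (q * w) (indVal (valEightAR (resTable ps)) (q * w)) (tabsEightA b ps q w) := by
  obtain ⟨hpr, hm0, hdv⟩ := facts hps
  have h8 : (8 : ℕ) ∣ q * w := hprod ▸ (dvd_mul_right 8 _).mul_right w
  have hj := isSignTab_jacTabs (Q := q * w) hb ps fun p hp => by
    obtain ⟨h1, h2⟩ := hdv (8 * w) p hp
    exact ⟨h1, by rw [← hprod]; convert h2 using 1; ring⟩
  have ht := isSignTab_twistTabs (by omega) (by norm_num) h8 hj (isSignTab_eightA b)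
    (fun s => tableVal_mod_length [0, 1, 0, 1, 0, -1, 0, -1] s) (val3_jacVal _)
    fun n => (val3_tableVal_eightA n).1
  refine (isSignTab_maskTabs (by omega) (Nat.one_le_iff_ne_zero.mpr hw) (dvd_mul_left w q) ht).congr
    fun n _ => mask_eq_indVal (valEightAR (resTable ps)) (fun n hn => ?_) n
  show tableVal [0, 1, 0, 1, 0, -1, 0, -1] n * jacVal (resTable ps) n = 0
  rw [← hprod, show (8 : ℕ) = 2 ^ 3 from rfl] at hn
  rcases even_or_of_gcd hn with he | hg
  · rw [(val3_tableVal_eightA n).2 he, zero_mul]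
  · rw [jacVal_resTable ps hpr, jac_eq_zero hm0 hg, mul_zero]

/-- **`tabsEightB` are the sign tables of `χ↑(q·w)`, `χ = χ₈·(·/m)`, `q = 8m`, `m = ∏ ps`.**
[cite: MontgomeryVaughan2007, §11.2.1 Exercise 8] -/
theorem isSignTab_tabsEightB {b q w : ℕ} (hb : 2 ≤ b) (ps : List ℕ) (hps : ps.Forall fun p ↦ p.Prime ∧ p ≠ 2)
    (hprod : 8 * ps.prod = q) (hw : w ≠ 0) :
    IsSignTab b (q * w) (indVal (valEightBR (resTable ps)) (q * w)) (tabsEightB b ps q w) := by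
  obtain ⟨hpr, hm0, hdv⟩ := facts hps
  have h8 : (8 : ℕ) ∣ q * w := hprod ▸ (dvd_mul_right 8 _).mul_right w
  have hj := isSignTab_jacTabs (Q := q * w) hb ps fun p hp => by
    obtain ⟨h1, h2⟩ := hdv (8 * w) p hp
    exact ⟨h1, by rw [← hprod]; convert h2 using 1; ring⟩
  have ht := isSignTab_twistTabs (by omega) (by norm_num) h8 hj (isSignTab_eightB b)
    (fun s => tableVal_mod_length [0, 1, 0, -1, 0, -1, 0, 1] s) (val3_jacVal _)
    fun n => (val3_tableVal_eightB n).1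
  refine (isSignTab_maskTabs (by omega) (Nat.one_le_iff_ne_zero.mpr hw) (dvd_mul_left w q) ht).congr
    fun n _ => mask_eq_indVal (valEightBR (resTable ps)) (fun n hn => ?_) n
  show tableVal [0, 1, 0, -1, 0, -1, 0, 1] n * jacVal (resTable ps) n = 0
  rw [← hprod, show (8 : ℕ) = 2 ^ 3 from rfl] at hn
  rcases even_or_of_gcd hn with he | hg
  · rw [(val3_tableVal_eightB n).2 he, zero_mul]
  · rw [jacVal_resTable ps hpr, jac_eq_zero hm0 hg, mul_zero]

end FeketePolyaKernel

end Literature.NumberTheory.LFunctions
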